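import Summits.NavierStokesRegularity.FluidComputer.PalasekTowerGermEvenProfile
import Literature.Analysis.FluidPDE.DivPotentialHeatPairing
import Literature.Analysis.FluidPDE.HeatFlowDivPotential
import Literature.Analysis.FluidPDE.SpaceTimeMollifier
import Literature.Analysis.FluidPDE.BallRadialMoments

/-!
# The germ host, XXVII: a NEAR-FIELD sup bound of the pressure gradient — the nonlocal acceleration
# `V = P(νΔU − (U·∇)U)` is bounded by LOCAL sup norms of the profile

Cell `ns-blowup`, seat `ns-blowup-ecbridge-3` (g5); GROUP C «BRIDGE SUPPORT» of the route
`PalasekTowerBreakdown` (crux `EpisodeBaseG`, item stmt-NavierStokesRegularity-19179, R2; line `slot` v5,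
stub `stub_explicit_slice_run` over `Germ.LineGermData`). Companion of `PalasekTowerGermHostExplicitBounds.lean`
(the `line`/`window` inequalities of the certificate slot reduced to sup numbers, among them a bound
`‖V‖ ≤ M` of the NONLOCAL acceleration `V = accel ν U`) and of g4's FAR-field bound
`PalasekTowerGermHostFarFieldBound.lean` (`‖∇π[U](x₀)‖ ≤ (3/(2πd⁴))∫‖U‖²` at distance `≥ d` from the support).
LABEL: E–C typing (KERNEL, proofs only). WHAT THIS IS NOT: not Navier–Stokes evidence — elementary potential
theory (the Newtonian gradient kernel is integrable near the origin); nothing about any flow after `τ₀`,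
`FirstEpisodeD`, `RungG 1` or blow-up.

## What

* §1 `setIntegral_ball_inv_norm_sq`: `∫_{|z|<R} (4π|z|²)⁻¹ dz = R` (polar coordinates) and its translate;
* §2 **`norm_newtonGradPotential_le_near`**: for `g` supported in `B̄(c, ρ)` (`ρ ≥ 0`), `|g| ≤ s`,
  and `ρ + dist(y, c) < R'`: `‖T_a g(y)‖ ≤ ‖a‖·s·R'` (`T_a g = ∫ ∂_aΓ(y − x) g(x) dx`); hence
  **`norm_gradient_divPotential_le_near`**: `‖∇π[G](y)‖ ≤ s·R'` when `|div G| ≤ s` — the NEAR-FIELD twin of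
  g4's far bound (no distance from the support needed);
* §3 **`norm_accel_le_near`**: `‖accel ν U (y)‖ ≤ ‖drift ν U (y)‖ + s·R'` for `tsupport U ⊆ B̄(0, ρ)`,
  `|div (drift ν U)| ≤ s`, `ρ + ‖y‖ < R'`; for a divergence-free profile `div (drift ν U) = −div((U·∇)U)` is a
  LOCAL quadratic expression in `DU` (ecbridge-4's `divergence_drift`), so **`norm_accel_le_near_of_isDivFree`**
  bounds the nonlocal `V` by `‖νΔU − (U·∇)U‖(y) + sup|div((U·∇)U)|·R'` — the number `M` of
  `line_anchor_of_bounds` in LOCAL terms;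
* §4 **`norm_gradient_fderiv_divPotential_le_near`**: the same for the pressure HESSIAN, one direction at a time
  (`∂ₐπ[G] = π[(div G) a]`, source `∂ₐ(div G)`), so `D(∇π)`, `DV` and the `window` fields `E`, `F` of
  `PalasekTowerGermHostExplicitBounds` are bounded by sup norms of derivatives of `U` alone.

References: D. Gilbarg, N. S. Trudinger, *Elliptic PDE of Second Order* (2001), Lemma 4.1 with (4.9)
[cite: GilbargTrudinger2001, Lemma 4.1 with (4.9)]; G. B. Folland, *Real Analysis* (1999), Thm. 2.49
[cite: Folland1999, Thm. 2.49]; A. J. Majda, A. L. Bertozzi, *Vorticity and Incompressible Flow* (CUP 2002),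
§1.8 Prop. 1.16 [cite: MajdaBertozziCUP2002, §1.8 Prop. 1.16].
-/

noncomputable section

namespace Summit.NavierStokesRegularity.FluidComputer.PalasekTowerClayBridge.Germ

open Set Function Filter Topology InnerProductSpace Metric MeasureTheory Real
open scoped Topology ContDiff RealInnerProductSpace Laplacian

open Literature.Analysis.FluidPDE

/-! ## §1 The gradient kernel is integrable on balls: `∫_{|z|<R} (4π|z|²)⁻¹ dz = R` -/

/-- `(4π|z|²)⁻¹` is integrable on every ball of `ℝ³` about the origin (the radial integrand
`y² · (4πy²)⁻¹ = 1/(4π)` on `(0, R)`). [cite: Folland1999, Thm. 2.49] -/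
theorem integrableOn_inv_four_pi_norm_sq_ball (R : ℝ) :
    IntegrableOn (fun z : EuclideanSpace ℝ (Fin 3) => (4 * π * ‖z‖ ^ 2)⁻¹)
      (ball (0 : EuclideanSpace ℝ (Fin 3)) R) volume := by
  have h := integrableOn_fun_norm_addHaar (volume : Measure (EuclideanSpace ℝ (Fin 3)))
    (f := fun y : ℝ => (4 * π * y ^ 2)⁻¹) (r := R)
  rw [finrank_euclideanSpace, Fintype.card_fin] at h
  refine h.2 ?_
  have heq : EqOn (fun y : ℝ => y ^ (3 - 1) • (4 * π * y ^ 2)⁻¹) (fun _ => (4 * π)⁻¹) (Ioo 0 R) := by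
    intro y hy
    have hy0 : y ≠ 0 := ne_of_gt hy.1
    have hπ : π ≠ 0 := Real.pi_pos.ne'
    show y ^ (3 - 1) • (4 * π * y ^ 2)⁻¹ = (4 * π)⁻¹
    rw [show (3 : ℕ) - 1 = 2 from rfl, smul_eq_mul]
    field_simp
  rw [integrableOn_congr_fun heq measurableSet_Ioo]
  exact integrableOn_const (by rw [Real.volume_Ioo]; exact ENNReal.ofReal_ne_top)

/-- **`∫_{|z|<R} (4π|z|²)⁻¹ dz = R`** (`R ≥ 0`; polar coordinates: `4π ∫₀^R y²(4πy²)⁻¹ dy = 4π · R/(4π)`).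
[cite: Folland1999, Thm. 2.49] -/
theorem setIntegral_ball_inv_norm_sq {R : ℝ} (hR : 0 ≤ R) :
    ∫ z in ball (0 : EuclideanSpace ℝ (Fin 3)) R, (4 * π * ‖z‖ ^ 2)⁻¹ = R := by
  rw [integral_ball_radial_fin_three (fun y : ℝ => (4 * π * y ^ 2)⁻¹) hR]
  have hπ := Real.pi_pos
  have hcongr : ∫ r in (0 : ℝ)..R, r ^ 2 * (4 * π * r ^ 2)⁻¹ = ∫ _ in (0 : ℝ)..R, (4 * π)⁻¹ := by
    refine intervalIntegral.integral_congr_ae (Eventually.of_forall fun r hr => ?_)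
    rw [uIoc_of_le hR] at hr
    have hr0 : r ≠ 0 := ne_of_gt hr.1
    field_simp
  rw [hcongr, intervalIntegral.integral_const, smul_eq_mul]
  field_simp
  ring

/-- The translated kernel `x ↦ (4π|y − x|²)⁻¹` is integrable on `B(y, R)`. [folklore] -/
theorem integrableOn_inv_four_pi_norm_sub_sq_ball (y : EuclideanSpace ℝ (Fin 3)) (R : ℝ) :
    IntegrableOn (fun x : EuclideanSpace ℝ (Fin 3) => (4 * π * ‖y - x‖ ^ 2)⁻¹) (ball y R) volume := by
  have hmp : MeasurePreserving (fun z : EuclideanSpace ℝ (Fin 3) => y + z) volume volume :=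
    measurePreserving_add_left volume y
  have hemb : MeasurableEmbedding (fun z : EuclideanSpace ℝ (Fin 3) => y + z) :=
    (Homeomorph.addLeft y).measurableEmbedding
  have hpre : (fun z : EuclideanSpace ℝ (Fin 3) => y + z) ⁻¹' ball y R = ball 0 R := by
    ext z; simp [mem_ball, dist_eq_norm]
  rw [← hmp.integrableOn_comp_preimage hemb, hpre]
  have hfun : (fun x : EuclideanSpace ℝ (Fin 3) => (4 * π * ‖y - x‖ ^ 2)⁻¹) ∘ (fun z => y + z) =
      fun z => (4 * π * ‖z‖ ^ 2)⁻¹ := by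
    funext z; simp [sub_add_cancel_left, norm_neg]
  rw [hfun]
  exact integrableOn_inv_four_pi_norm_sq_ball R

/-- `∫_{B(y, R)} (4π|y − x|²)⁻¹ dx = R` (`R ≥ 0`). [cite: Folland1999, Thm. 2.49] -/
theorem setIntegral_ball_inv_norm_sub_sq (y : EuclideanSpace ℝ (Fin 3)) {R : ℝ} (hR : 0 ≤ R) :
    ∫ x in ball y R, (4 * π * ‖y - x‖ ^ 2)⁻¹ = R := by
  have hmp : MeasurePreserving (fun z : EuclideanSpace ℝ (Fin 3) => y + z) volume volume :=
    measurePreserving_add_left volume y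
  have hemb : MeasurableEmbedding (fun z : EuclideanSpace ℝ (Fin 3) => y + z) :=
    (Homeomorph.addLeft y).measurableEmbedding
  have hpre : (fun z : EuclideanSpace ℝ (Fin 3) => y + z) ⁻¹' ball y R = ball 0 R := by
    ext z; simp [mem_ball, dist_eq_norm]
  have h := hmp.setIntegral_preimage_emb hemb (fun x : EuclideanSpace ℝ (Fin 3) => (4 * π * ‖y - x‖ ^ 2)⁻¹)
    (ball y R)
  rw [hpre] at h
  rw [← h]
  simp only [sub_add_cancel_left, norm_neg]
  exact setIntegral_ball_inv_norm_sq hR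

/-! ## §2 The near-field bound of the gradient potential -/

section Near

variable {g : EuclideanSpace ℝ (Fin 3) → ℝ} {c y : EuclideanSpace ℝ (Fin 3)} {ρ s R' : ℝ}

/-- **NEAR-FIELD BOUND OF A GRADIENT POTENTIAL**: if `g` is supported in `B̄(c, ρ)` (`ρ ≥ 0`),
`|g| ≤ s` everywhere, and `ρ + dist(y, c) < R'`, then `‖T_a g (y)‖ ≤ ‖a‖ · s · R'`
(`‖∂_aΓ(y − x) a‖ ≤ ‖a‖/(4π‖y − x‖²)`, the support lies in `B(y, R')`, and `∫_{B(y,R')} (4π|y − x|²)⁻¹ = R'`).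
[cite: GilbargTrudinger2001, Lemma 4.1 with (4.9)] -/
theorem norm_newtonGradPotential_le_near (hρ : 0 ≤ ρ) (hsupp : tsupport g ⊆ closedBall c ρ)
    (hs : ∀ x, |g x| ≤ s) (hR' : ρ + dist y c < R') (a : EuclideanSpace ℝ (Fin 3)) :
    ‖newtonGradPotential a g y‖ ≤ ‖a‖ * s * R' := by
  have hs0 : 0 ≤ s := (abs_nonneg _).trans (hs y)
  have hR0 : 0 ≤ R' := by linarith [dist_nonneg (x := y) (y := c)]
  -- pointwise domination by the indicator of `B(y, R')`
  have hpt : ∀ x, ‖fderiv ℝ newtonKernel (y - x) a • g x‖ ≤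
      (ball y R').indicator (fun x => ‖a‖ * s * (4 * π * ‖y - x‖ ^ 2)⁻¹) x := by
    intro x
    by_cases hx : x ∈ tsupport g
    · have hxb : x ∈ ball y R' := by
        rw [mem_ball]
        have h1 : dist x c ≤ ρ := mem_closedBall.1 (hsupp hx)
        calc dist x y ≤ dist x c + dist c y := dist_triangle _ _ _
          _ = dist x c + dist y c := by rw [dist_comm c y]
          _ < R' := by linarith
      rw [indicator_of_mem hxb, norm_smul, Real.norm_eq_abs]
      have hK : ‖fderiv ℝ newtonKernel (y - x) a‖ ≤ (4 * π * ‖y - x‖ ^ 2)⁻¹ * ‖a‖ :=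
        (ContinuousLinearMap.le_opNorm _ _).trans
          (mul_le_mul_of_nonneg_right (norm_fderiv_newtonKernel_le (y - x)) (norm_nonneg _))
      have hK0 : 0 ≤ (4 * π * ‖y - x‖ ^ 2)⁻¹ * ‖a‖ := by positivity
      calc ‖fderiv ℝ newtonKernel (y - x) a‖ * |g x| ≤ (4 * π * ‖y - x‖ ^ 2)⁻¹ * ‖a‖ * s :=
            mul_le_mul hK (hs x) (abs_nonneg _) hK0
        _ = ‖a‖ * s * (4 * π * ‖y - x‖ ^ 2)⁻¹ := by ring
    · have h0 : g x = 0 := image_eq_zero_of_notMem_tsupport hx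
      rw [h0, smul_zero, norm_zero]
      exact Set.indicator_nonneg (fun z _ => by positivity) x
  have hint : Integrable ((ball y R').indicator fun x => ‖a‖ * s * (4 * π * ‖y - x‖ ^ 2)⁻¹) :=
    (integrable_indicator_iff measurableSet_ball).2
      ((integrableOn_inv_four_pi_norm_sub_sq_ball y R').const_mul (‖a‖ * s))
  rw [newtonGradPotential]
  calc ‖∫ x, fderiv ℝ newtonKernel (y - x) a • g x‖ ≤ ∫ x, ‖fderiv ℝ newtonKernel (y - x) a • g x‖ :=
        norm_integral_le_integral_norm _
    _ ≤ ∫ x, (ball y R').indicator (fun x => ‖a‖ * s * (4 * π * ‖y - x‖ ^ 2)⁻¹) x :=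
        integral_mono_of_nonneg (Eventually.of_forall fun x => norm_nonneg _) hint
          (Eventually.of_forall hpt)
    _ = ‖a‖ * s * R' := by
        rw [integral_indicator measurableSet_ball, integral_const_mul, setIntegral_ball_inv_norm_sub_sq y hR0]

/-- The divergence of a field supported in `B̄(c, ρ)` is supported there. [folklore] -/
theorem tsupport_divergence_subset {G : EuclideanSpace ℝ (Fin 3) → EuclideanSpace ℝ (Fin 3)}
    (hsupp : tsupport G ⊆ closedBall c ρ) :
    tsupport (VectorCalculus.divergence G) ⊆ closedBall c ρ :=
  closure_minimal (fun x hx => by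
    by_contra h
    exact hx (divergence_eq_zero_of_notMem_tsupport fun h' => h (hsupp h'))) isClosed_closedBall

/-- **NEAR-FIELD BOUND OF THE PRESSURE GRADIENT**: for a smooth compactly supported field `G` with
`tsupport G ⊆ B̄(c, ρ)` (`ρ ≥ 0`) and `|div G| ≤ s` everywhere, `‖∇π[G](y)‖ ≤ s · R'` whenever
`ρ + dist(y, c) < R'` (`π[G] = Δ⁻¹ div G`). [cite: GilbargTrudinger2001, Lemma 4.1 with (4.9)] -/
theorem norm_gradient_divPotential_le_near {G : EuclideanSpace ℝ (Fin 3) → EuclideanSpace ℝ (Fin 3)}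
    (hG : ContDiff ℝ ∞ G) (hGc : HasCompactSupport G) (hρ : 0 ≤ ρ) (hsupp : tsupport G ⊆ closedBall c ρ)
    (hs : ∀ x, |VectorCalculus.divergence G x| ≤ s) (hR' : ρ + dist y c < R') :
    ‖gradient (divPotential G) y‖ ≤ s * R' := by
  have hs0 : 0 ≤ s := (abs_nonneg _).trans (hs y)
  have hR0 : 0 ≤ R' := by linarith [dist_nonneg (x := y) (y := c)]
  have e : gradient (divPotential G) y =
      (InnerProductSpace.toDual ℝ (EuclideanSpace ℝ (Fin 3))).symm (fderiv ℝ (divPotential G) y) := rfl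
  rw [e, LinearIsometryEquiv.norm_map]
  refine ContinuousLinearMap.opNorm_le_bound _ (by positivity) fun a => ?_
  rw [fderiv_divPotential_apply hG hGc y a]
  calc ‖newtonGradPotential a (VectorCalculus.divergence G) y‖ ≤ ‖a‖ * s * R' :=
        norm_newtonGradPotential_le_near hρ (tsupport_divergence_subset hsupp) hs hR' a
    _ = s * R' * ‖a‖ := by ring

end Near

/-! ## §3 The acceleration of a profile: nonlocal, but bounded by local sup norms -/

section Accel

variable {U : EuclideanSpace ℝ (Fin 3) → EuclideanSpace ℝ (Fin 3)} {ρ s R' : ℝ} {y : EuclideanSpace ℝ (Fin 3)}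

/-- **`‖V(y)‖ ≤ ‖W(y)‖ + s·R'`** (`V = accel ν U = W − ∇π`, `W = drift ν U = νΔU − (U·∇)U`): for a smooth
profile with `tsupport U ⊆ B̄(0, ρ)` (`ρ ≥ 0`), `|div W| ≤ s` everywhere and `ρ + ‖y‖ < R'`.
[cite: MajdaBertozziCUP2002, §1.8 Prop. 1.16] -/
theorem norm_accel_le_near (hU : ContDiff ℝ ∞ U) (hUc : HasCompactSupport U) (ν : ℝ) (hρ : 0 ≤ ρ)
    (hsupp : tsupport U ⊆ closedBall 0 ρ) (hs : ∀ x, |VectorCalculus.divergence (drift ν U) x| ≤ s)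
    (hR' : ρ + ‖y‖ < R') : ‖accel ν U y‖ ≤ ‖drift ν U y‖ + s * R' := by
  have hdsupp : tsupport (drift ν U) ⊆ closedBall 0 ρ :=
    closure_minimal (fun x hx => by
      by_contra h
      exact hx (drift_eq_zero_of_notMem_tsupport ν fun h' => h (hsupp h'))) isClosed_closedBall
  have hπ : ‖gradient (pot ν U) y‖ ≤ s * R' :=
    norm_gradient_divPotential_le_near (contDiff_drift hU ν) (hasCompactSupport_drift hUc ν) hρ hdsupp hs
      (by rwa [dist_zero_right])
  rw [accel_apply]
  exact (norm_sub_le _ _).trans (by linarith)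

/-- **The same for a DIVERGENCE-FREE profile, with the LOCAL source `div((U·∇)U)`**: `div W = −div((U·∇)U)`
(`divergence_drift`), so `|div((U·∇)U)| ≤ s` everywhere gives `‖V(y)‖ ≤ ‖W(y)‖ + s·R'` for `ρ + ‖y‖ < R'` —
the sup bound `M` of the line anchor (`line_anchor_of_bounds`) from sup norms of `U`, `DU`, `D²U` alone.
[cite: MajdaBertozziCUP2002, §1.8 Prop. 1.16] -/
theorem norm_accel_le_near_of_isDivFree (hU : ContDiff ℝ ∞ U) (hUc : HasCompactSupport U)
    (hdiv : VectorCalculus.IsDivFree U) (ν : ℝ) (hρ : 0 ≤ ρ) (hsupp : tsupport U ⊆ closedBall 0 ρ)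
    (hs : ∀ x, |VectorCalculus.divergence (convect U U) x| ≤ s) (hR' : ρ + ‖y‖ < R') :
    ‖accel ν U y‖ ≤ ‖drift ν U y‖ + s * R' := by
  refine norm_accel_le_near hU hUc ν hρ hsupp (fun x => ?_) hR'
  rw [divergence_drift hU hdiv x, abs_neg]
  exact hs x

/-- **Uniform form on the support ball**: with `|div((U·∇)U)| ≤ s` and `‖νΔU − (U·∇)U‖ ≤ w` everywhere,
`‖V(y)‖ ≤ w + s·R'` for every `y` with `‖y‖ ≤ ρ` as soon as `2ρ < R'` (e.g. `R' = 2ρ + 1`). Off the support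
`V = −∇π` and the FAR bound of `PalasekTowerGermHostFarFieldBound` takes over. [cite: MajdaBertozziCUP2002, §1.8 Prop. 1.16] -/
theorem norm_accel_le_of_norm_le (hU : ContDiff ℝ ∞ U) (hUc : HasCompactSupport U)
    (hdiv : VectorCalculus.IsDivFree U) (ν : ℝ) (hρ : 0 ≤ ρ) (hsupp : tsupport U ⊆ closedBall 0 ρ) {w : ℝ}
    (hw : ∀ x, ‖drift ν U x‖ ≤ w) (hs : ∀ x, |VectorCalculus.divergence (convect U U) x| ≤ s)
    (hR' : 2 * ρ < R') (hy : ‖y‖ ≤ ρ) : ‖accel ν U y‖ ≤ w + s * R' := by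
  have h := norm_accel_le_near_of_isDivFree hU hUc hdiv ν hρ hsupp hs (show ρ + ‖y‖ < R' by linarith)
  linarith [hw y]

end Accel


/-! ## §4 Second derivatives of the pressure: the near bound applied to `∂ₐ div G` -/

section Hessian

variable {G : EuclideanSpace ℝ (Fin 3) → EuclideanSpace ℝ (Fin 3)} {c y : EuclideanSpace ℝ (Fin 3)} {ρ R' : ℝ}

/-- `∂ₐπ[G] = π[(div G) a]` as functions (the tree's `fderiv_divPotential_apply_eq_divPotential_smul`,
pointwise). [cite: GilbargTrudinger2001, Lemma 4.1] -/
theorem fderiv_divPotential_eq_divPotential_smul (hG : ContDiff ℝ ∞ G) (hGc : HasCompactSupport G)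
    (a : EuclideanSpace ℝ (Fin 3)) :
    (fun y => fderiv ℝ (divPotential G) y a) =
      divPotential (fun x => (VectorCalculus.divergence G x) • a) :=
  funext fun y => fderiv_divPotential_apply_eq_divPotential_smul hG hGc y a

/-- **NEAR-FIELD BOUND OF THE PRESSURE HESSIAN** (one direction at a time): for a smooth compactly supported
field `G` with `tsupport G ⊆ B̄(c, ρ)` (`ρ ≥ 0`) and `|∂ₐ(div G)| ≤ sₐ` everywhere,
`‖∇(∂ₐπ[G])(y)‖ ≤ sₐ · R'` whenever `ρ + dist(y, c) < R'` — `∂ₐπ[G]` is itself the potential `π[(div G) a]`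
whose source `div((div G) a) = ∂ₐ(div G)` is again a LOCAL derivative of `G`. With `G = νΔU − (U·∇)U` this
bounds `D(∇π)`, hence `DV = DW − D(∇π)` and the fields `E`, `F` of `window_of_field_bounds`, by sup norms of
derivatives of `U` alone. [cite: GilbargTrudinger2001, Lemma 4.1 with (4.9)] -/
theorem norm_gradient_fderiv_divPotential_le_near (hG : ContDiff ℝ ∞ G) (hGc : HasCompactSupport G)
    (hρ : 0 ≤ ρ) (hsupp : tsupport G ⊆ closedBall c ρ) (a : EuclideanSpace ℝ (Fin 3)) {sₐ : ℝ}
    (hs : ∀ x, |fderiv ℝ (VectorCalculus.divergence G) x a| ≤ sₐ) (hR' : ρ + dist y c < R') :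
    ‖gradient (fun y => fderiv ℝ (divPotential G) y a) y‖ ≤ sₐ * R' := by
  rw [fderiv_divPotential_eq_divPotential_smul hG hGc a]
  have hdiff : Differentiable ℝ (VectorCalculus.divergence G) :=
    (contDiff_divergence_of_contDiff_top hG).differentiable (by simp)
  refine norm_gradient_divPotential_le_near (contDiff_divergence_smul_const hG a)
    (hasCompactSupport_divergence_smul_const hGc a) hρ ?_ (fun x => ?_) hR'
  · refine closure_minimal (fun x hx => ?_) isClosed_closedBall
    by_contra h
    exact hx (by simp [divergence_eq_zero_of_notMem_tsupport fun h' => h (hsupp h')])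
  · rw [divergence_smul_const a (hdiff x)]
    exact hs x

end Hessian

end Summit.NavierStokesRegularity.FluidComputer.PalasekTowerClayBridge.Germ

end
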